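import Literature.AnabelianGeometry.EtaleTheta.SettingModelChiTheta
import Literature.AnabelianGeometry.EtaleTheta.SettingModelChiCusp
import HarnessLib

/-!
# The χ-twisted root model of [EtTh] §1 WITH A CUSP, file F5c: `ThetaSetting.modelχ′ p` over `curveχ′`

Mochizuki, *The étale theta function …*, Publ. RIMS **45** (2009) [EtTh], §1, PRIMS PDF pp. 11–14
[cite: MochizukiEtTh2009, §1 p.12]: "`Π^tp_Y`", "`(Π^tp_X)^Θ`", "`Y_N`", "`Z_N`", "any decomposition group of a cusp
of `Y^log`" (p. 13).  Layer L2 of the abc-iut cell, R78 cluster (integrator abc-iut-L6-d6, R78-MAP #7: row F5c →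
abc-iut-w5-d029, first refusal abc-iut-L2-t1 g4): abc-iut-L2-t1's F5b record `ThetaSetting.modelχ p`
(`SettingModelChiTheta`, over abc-iut-w5-d249's `curveχ p`, no closed point) TRANSCRIBED over this seat's
`curveχ′ p` (`SettingModelChiCusp`, p429840: the SAME `Π^tp_X = Γ ⋊_χ G_{ℚ_p}`, `aug`, `Π_X`, `toHat`, with ONE
synthetic cusp whose inertia is the Tate-twisted `b`-axis).  Every field is F5b's verbatim (the carriers agree
definitionally; the theta quotients are abc-iut-L2-d1's `CurveTheta` package re-keyed at `curveχ′`):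

* `thetaKerχ'_normal`, `ellKerχ'_normal` — the `Normal` instances re-exported at the concrete carrier (the
  instance-retrieval remark of `ThetaQuotientsOfCurve` / `SettingModelChiLevelKernels`);
* **`ThetaSetting.modelχ′ p : ThetaSetting p`** with `toTemperedCurve := curveχ′ p`;
* `modelχ′_isEtThOrigin` (`Δ_X = inl(F̂₂)` free on two generators), `hYcl_modelχ′`, `isOpenMap_aug_modelχ′`,
  `toZ_modelχ′_apply` (`toZ g = pr₂ g.left`), and the cusp bookkeeping a consumer needs:
  `decomp_modelχ′_le_ker_toZ` ((P3) «decomposition groups of cusps lie in `Π^tp_Y`»), `map_aug_decomp_modelχ′`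
  ((P4)), `exists_isCusp_modelχ′` ((P2)) — the inputs of abc-iut-w5-d111's `OncePuncturedData` inhabitant.

HONEST LABEL: semi-synthetic model (consistency evidence for the interfaces; the cusp is the Tate-twisted `b`-axis,
not print's commutator axis — `SettingModelCuspAxis`); nothing of [EtTh] asserted; no side taken on [IUTchIII]
Cor. 3.12.  Class (b) construction; F5b / F4 / F4c untouched; the only instances are the two re-keyed `Normal`
instances on the concrete carrier (as in `SettingModelChiLevelKernels`).
-/

noncomputable section

open Topology Function

namespace Literature.AnabelianGeometry.EtaleTheta.SettingModel

open Literature.AnabelianGeometry.SemiGraphs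

variable (p : ℕ) [Fact p.Prime]

/-- `Ker(Π^tp_X ↠ (Π^tp_X)^Θ) ⊴ Π^tp_X` re-exported at the carrier of `curveχ′` (instance retrieval keys the
carrier). [cite: MochizukiEtTh2009, §1 p.12] -/
instance thetaKerχ'_normal : (CurveTheta.thetaKer (curveχ' p)).Normal := CurveTheta.thetaKer_normal _

/-- `Ker(Π^tp_X ↠ (Π^tp_X)^ell) ⊴ Π^tp_X` at `curveχ′`. [cite: MochizukiEtTh2009, §1 p.12] -/
instance ellKerχ'_normal : (CurveTheta.ellKer (curveχ' p)).Normal := CurveTheta.ellKer_normal _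

/-- The theta kernels of `curveχ′` and `curveχ` coincide (same carriers). [cite: MochizukiEtTh2009, §1 p.12] -/
theorem thetaKer_curveχ'_eq : CurveTheta.thetaKer (curveχ' p) = CurveTheta.thetaKer (curveχ p) := rfl

/-- `Ker ↠ (Π^tp_X)^Θ ∩ Π^tp_{Y_N} ≤ Π^tp_{Z_N}` at `curveχ′` (F5b's clause, same carrier).
[cite: MochizukiEtTh2009, §1 p.14] -/
theorem thetaKer_inf_YNχ_le_ZNχ' (N : ℕ+) : CurveTheta.thetaKer (curveχ' p) ⊓ YNχ p N ≤ ZNχ p N :=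
  thetaKer_inf_YNχ_le_ZNχ p N

/-- **The χ-twisted model of the [EtTh] §1 root WITH A CUSP** — F5b's record over `curveχ′ p`.
[cite: MochizukiEtTh2009, §1 p.11] -/
abbrev _root_.Literature.AnabelianGeometry.EtaleTheta.ThetaSetting.modelχ' : ThetaSetting p where
  toTemperedCurve := curveχ' p
  qX := qModel p
  qX_mem := qModel_mem_botχ p
  norm_qX_lt_one := (ThetaSetting.model p).norm_qX_lt_one
  qX_ne_zero := qModel_ne_zeroχ p
  sqrtqX := ((p : ℕ) : PadicAlgCl p)
  sqrtqX_sq := rfl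
  toZ := (chiTwistData p).toZ
  toZ_surjective := (chiTwistData p).toZ_surjective
  isOpen_ker_toZ := (chiTwistData p).isOpen_ker_toZ (continuous_leftRight p)
  toZ_delta_surjective := (chiTwistData p).toZ_restrict_surjective
  GtpTheta := CurveTheta.GTheta (curveχ' p)
  toTheta := CurveTheta.toTheta (curveχ' p)
  continuous_toTheta := CurveTheta.continuous_toTheta (curveχ' p)
  toTheta_surjective := CurveTheta.toTheta_surjective (curveχ' p)
  ker_toTheta := CurveTheta.ker_toTheta (curveχ' p)
  GtpEll := CurveTheta.GEll (curveχ' p)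
  thetaToEll := CurveTheta.thetaToEll (curveχ' p)
  continuous_thetaToEll := CurveTheta.continuous_thetaToEll (curveχ' p)
  thetaToEll_surjective := CurveTheta.thetaToEll_surjective (curveχ' p)
  ker_toEll := CurveTheta.ker_toEll (curveχ' p)
  ker_thetaToEll_comm := CurveTheta.ker_thetaToEll_comm (curveχ' p)
  ker_thetaToEll_central := CurveTheta.ker_thetaToEll_central (curveχ' p)
  GtpYN := YNχ p
  GtpYN_one := YNχ_one p
  GtpYN_le := YNχ_le p
  map_aug_GtpYN N := map_rightHom_YNχ p N
  GtpYN_normal := YNχ_normal p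
  isOpen_GtpYN N := isOpen_YNχ p (continuous_leftRight p) N (isOpen_fixingSubgroup_fieldKN ⊥ (qModel p) N)
  GtpYN_anti M N h := YNχ_anti p h
  relIndex_deltaYN N := relIndex_YNχ p N
  GtpZN := ZNχ p
  GtpZN_le := ZNχ_le_YNχ p
  map_aug_GtpZN N := map_rightHom_ZNχ p N
  GtpZN_normal := ZNχ_normal p
  isOpen_GtpZN N := isOpen_ZNχ p (continuous_leftRight p) N (isOpen_fixingSubgroup_fieldJN ⊥ (qModel p) N)
  GtpZN_anti M N h := ZNχ_anti p h
  relIndex_deltaZN N := relIndex_ZNχ p N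
  ker_toTheta_le_GtpZN N := by
    rw [CurveTheta.ker_toTheta]
    exact thetaKer_inf_YNχ_le_ZNχ' p N

/-- **The cusped χ-model satisfies the guard `IsEtThOrigin`.** [cite: MochizukiEtTh2009, §1 p.12] -/
theorem _root_.Literature.AnabelianGeometry.EtaleTheta.ThetaSetting.modelχ'_isEtThOrigin :
    (ThetaSetting.modelχ' p).IsEtThOrigin :=
  ThetaSetting.IsEtThOrigin.of_free (isFreeProfiniteOnTwo_deltaHatχ p)

/-- `toZ` of the cusped χ-model is `pr₂ ∘ left`. [cite: MochizukiEtTh2009, §1 p.12] -/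
theorem toZ_modelχ'_apply (g : PiTpχ p) : (ThetaSetting.modelχ' p).toZ g = gfpSnd g.left := rfl

/-- **(P3) «decomposition groups of cusps lie in `Π^tp_Y = Ker(Π^tp_X ↠ Z)`»** at `modelχ′` (the `b`-axis has
`a`-degree `0`). [cite: MochizukiEtTh2009, §1 p.13] -/
theorem decomp_modelχ'_le_ker_toZ (x : (ThetaSetting.modelχ' p).Pt) :
    (ThetaSetting.modelχ' p).decomp x ≤ (ThetaSetting.modelχ' p).toZ.ker := fun g hg => by
  rw [MonoidHom.mem_ker]
  exact gfpSnd_left_eq_one_of_mem_decomp_curveχ' p x hg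

/-- **(P4)** the cusp is `K`-rational: `D_x ↠ G_K`. [cite: MochizukiEtTh2009, §1 p.13] -/
theorem map_aug_decomp_modelχ' (x : (ThetaSetting.modelχ' p).Pt) :
    ((ThetaSetting.modelχ' p).decomp x).map (ThetaSetting.modelχ' p).aug.toMonoidHom = (ThetaSetting.modelχ' p).GK :=
  map_aug_decomp_curveχ' p x

/-- **(P2)** `modelχ′` has a cusp. [cite: MochizukiEtTh2009, §1 p.12] -/
theorem exists_isCusp_modelχ' : ∃ x : (ThetaSetting.modelχ' p).Pt, (ThetaSetting.modelχ' p).IsCusp x :=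
  ⟨(), trivial⟩

/-- **(P1)** `Ker(Π_X → G_{ℚ_p}) = Δ_X` at `modelχ′`. [cite: MochizukiEtTh2009, §1 p.12] -/
theorem ker_augHat_modelχ' :
    (ThetaSetting.modelχ' p).augHat.toMonoidHom.ker = (ThetaSetting.modelχ' p).DeltaHat := by
  change (augHatχ p).toMonoidHom.ker = (curveχ p).DeltaHat
  rw [deltaHatχ_eq]
  rfl

/-- `hYcl` holds at `modelχ′` (same subgroups as at `modelχ`). [cite: MochizukiEtTh2009, §1 p.12] -/
theorem hYcl_modelχ' :
    ((ThetaSetting.modelχ' p).DtpY.map (ThetaSetting.modelχ' p).toHat.toMonoidHom).topologicalClosure ≤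
      (ThetaSetting.modelχ' p).DtpY.map (ThetaSetting.modelχ' p).toHat.toMonoidHom ⊔
        (⁅⁅(ThetaSetting.modelχ' p).DeltaHat, (ThetaSetting.modelχ' p).DeltaHat⁆,
          (ThetaSetting.modelχ' p).DeltaHat⁆).topologicalClosure :=
  hYcl_modelχ p

/-- `aug` is open at `modelχ′`. [cite: MochizukiEtTh2009, §1 p.12] -/
theorem isOpenMap_aug_modelχ' : IsOpenMap (ThetaSetting.modelχ' p).aug := isOpenMap_augχ p

/-- A `ThetaSetting` with the guard AND a cusp exists. [cite: MochizukiEtTh2009, §1 p.12] -/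
theorem _root_.Literature.AnabelianGeometry.EtaleTheta.ThetaSetting.exists_isEtThOrigin_and_isCusp :
    ∃ D : ThetaSetting p, D.IsEtThOrigin ∧ ∃ x : D.Pt, D.IsCusp x :=
  ⟨ThetaSetting.modelχ' p, ThetaSetting.modelχ'_isEtThOrigin p, (), trivial⟩

end Literature.AnabelianGeometry.EtaleTheta.SettingModel

end
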